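import Summits.BirchSwinnertonDyer.BirchSwinnertonDyer.Theorems.BiquadraticEisensteinDescentEisensteinHeartFlatCMInertBadKPrimeBiquadraticPrimes
import Summits.BirchSwinnertonDyer.Rank1Residual.Additive.SemistabilityDefectRamification
import Summits.BirchSwinnertonDyer.Rank1Residual.Additive.SubGordHigherOrdinary
import Literature.NumberTheory.EllipticCurves.RankinSelbergBaseChangeBadPrimesProofs
import Literature.NumberTheory.EllipticCurves.ComplexMultiplicationNotSemistable
import Literature.NumberTheory.EllipticCurves.ComplexMultiplicationRationalJIntegralProofs
import HarnessLib

set_option linter.dupNamespace false -- `Summit.BirchSwinnertonDyer.BirchSwinnertonDyer.Theorems.…` (summit = sub)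
set_option autoImplicit false

/-!
# Crux `EisensteinHeartFlatCMInertBadKPrime` (stmt-BirchSwinnertonDyer-21341), line `hsieh-lambda`, layer 2 —
# INSTANTIATION tranche 2: the branch character `λ = (ψ ∘ N_{L/K_CM}) · ν` is RAMIFIED at both primes of `L` above `p`
# (hypothesis (R) `hramS`/`hramT` of the V2 socket `…KatzHsiehDisplay.exists_span_C_mul_eq` at `S ⊇ {w ∣ p}`, `Σ_p = {𝔓′}`)

Sequel of `…BiquadraticPrimes.lean` (width seat `bsd-wall-cm-bed-w2`; THEOREMS ONLY, helper toward
stmt-BirchSwinnertonDyer-21341, nothing about the crux's input or any case of BSD asserted).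

## What is proved

Abstract setting: number fields `K₁ ⊂ L` (route: `K₁ = K_CM`, `L = K_CM·K′`), a prime `v` of `K₁` above `p`, and — the output of
`…BiquadraticPrimes.primes_above_eq_and_degrees` — EVERY prime of `L` above `p` has ramification index `1` over `ℤ`.

* §1 `v` is unramified in `L/K₁` (`isUnramifiedIn_of_forall_ramificationIdx_eq_one`: `e(𝔓|v) ∣ e(𝔓|p) = 1`, and `e = 1` is
  unramifiedness over a finite residue field, Mathlib `Ideal.ramificationIdx_eq_one_iff`), and `e(v|p) = 1`
  (`ramificationIdx_eq_one_below`). Hence, by the tree's descent of unramifiedness along the norm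
  (`HeckeCharacter.not_isUnramifiedAt_compRelNorm`, Childress Lemma 5.3 (a)): **a Hecke character `ψ` of `K₁` RAMIFIED at `v`
  has `ψ ∘ N_{L/K₁}` ramified at every prime `𝔓` of `L` above `v`**, and so has `(ψ ∘ N_{L/K₁}) · ν` for any `ν`
  unramified at `𝔓` (`not_isUnramifiedAt_compRelNorm_mul`) — e.g. `ν = N_L⁻¹` or any everywhere-unramified twist.
* §2 the elliptic-curve input «`ψ_W` is ramified at `p𝓞_{K_CM}`» WITHOUT Gross's conductor formula: for `W/ℚ` additive and
  potentially good at `p ≥ 5` (`Addv W p`, `0 ≤ ord_p j` — automatic for CM `W` bad at `p`), and ANY number field `F` with a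
  prime `w ∋ p` of ramification index `1`, `W_F` has BAD reduction at `w` (`not_hasGoodReductionAt_baseChange_of_ramificationIdx_eq_one`:
  good reduction upstairs forces the semistability index `e_W(p) ∣ e(w|p) = 1`, tree
  `semistabilityIndex_dvd_ramificationIdx_of_hasGoodReductionAt`, against `semistabilityIndex_ne_one_of_addv`); with Deuring's
  clause (iii) «`ψ` unramified at `w` iff `W_{K_CM}` good at `w`» (a binder, the shape of
  `Deuring_exists_heckeCharacter_of_maximalCM`) this gives `¬ ψ.IsUnramifiedAt v` (`not_isUnramifiedAt_of_deuring`).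
* §3 at the route's frame (`branch_not_isUnramifiedAt`): `W` CM and bad at `p ≥ 5`, `L` quartic with `√d ∈ L`, `d` a non-square mod
  `p`, two distinct primes of `L` above `p` (from `K′`), `K_CM ⊂ L` Galois with `v ∋ p`, `ψ` with Deuring (iii), `ν` unramified above
  `p` ⟹ `(ψ.compRelNorm L) * ν` is ramified at every prime of `L` above `v`.
* §4 (appended) `p` is INERT in the quadratic `K₁ ∋ √d` (`eq_and_degrees_of_inert`: the prime above `p` is unique, `e = 1`, `f = 2`),
  so (R) holds at EVERY prime of `L` above `p` (`branch_not_isUnramifiedAt_of_natCast_mem` — the `hramS`/`hramT` shape on `{w ∣ p}`).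

References: [Childress2009] Ch. 4 §5 Lemma 5.3 (a); [NeukirchANT1999] Ch. I §8; [SilvermanAEC2009] VII.5.1; [SilvermanATAEC1994]
II Thm. 9.2 (b).
-/

noncomputable section

open scoped Classical NumberField
open NumberField IsDedekindDomain Module

namespace Summit.BirchSwinnertonDyer.BirchSwinnertonDyer.Theorems.BiquadraticEisensteinDescentEisensteinHeartFlatCMInertBadKPrimeBranchRamification

open Literature.NumberTheory.EllipticCurves Literature.NumberTheory.GaloisRepresentations
open Summit.BirchSwinnertonDyer.BirchSwinnertonDyer.Theorems.BiquadraticEisensteinDescentEisensteinHeartFlatCMInertBadKPrimeBiquadraticPrimes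

variable {K₁ L : Type} [Field K₁] [NumberField K₁] [Field L] [NumberField L] [Algebra K₁ L]
variable {p : ℕ} [hp : Fact p.Prime]

/-! ### §1 `v` unramified in `L/K₁` from `e(𝔓|p) = 1`; ramification of `ψ ∘ N_{L/K₁}` above `v` -/

omit [NumberField K₁] [NumberField L] hp in
/-- A prime of `L` over a prime `v ∋ p` of `K₁` contains `p`. [folklore] -/
theorem natCast_mem_of_liesOver_ideal {v : HeightOneSpectrum (𝓞 K₁)} (hv : ((p : ℕ) : 𝓞 K₁) ∈ v.asIdeal)
    {𝔓 : Ideal (𝓞 L)} [h : 𝔓.LiesOver v.asIdeal] : ((p : ℕ) : 𝓞 L) ∈ 𝔓 := by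
  have hmem : ((p : ℕ) : 𝓞 K₁) ∈ 𝔓.under (𝓞 K₁) := by rw [← h.over]; exact hv
  rw [Ideal.mem_comap, map_natCast] at hmem
  exact hmem

/-- **`v` is unramified in `L/K₁` when every prime of `L` above `p ∈ v` has ramification index `1` over `ℤ`**:
`e(𝔓|v) ∣ e(𝔓|p) = 1` and ramification index one over a finite residue field is unramifiedness.
[cite: NeukirchANT1999, Ch. I §8 (multiplicativity of `e` in towers)] -/
theorem isUnramifiedIn_of_forall_ramificationIdx_eq_one (v : HeightOneSpectrum (𝓞 K₁))
    (hv : ((p : ℕ) : 𝓞 K₁) ∈ v.asIdeal)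
    (h : ∀ 𝔔 : HeightOneSpectrum (𝓞 L), ((p : ℕ) : 𝓞 L) ∈ 𝔔.asIdeal → 𝔔.asIdeal.ramificationIdx ℤ = 1) :
    Algebra.IsUnramifiedIn (𝓞 L) v.asIdeal := by
  intro 𝔓 h𝔓 hlo
  have hP : ((p : ℕ) : 𝓞 L) ∈ 𝔓 := natCast_mem_of_liesOver_ideal hv
  have he : 𝔓.ramificationIdx ℤ = 1 := h ⟨𝔓, h𝔓, ne_bot_of_mem hP⟩ hP
  have hdvd : 𝔓.ramificationIdx (𝓞 K₁) ∣ 𝔓.ramificationIdx ℤ := Ideal.ramificationIdx_above_dvd (R := ℤ) v.asIdeal 𝔓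
  rw [he, Nat.dvd_one] at hdvd
  exact Ideal.ramificationIdx_eq_one_iff.mp hdvd

omit [NumberField L] hp in
/-- `e(v|p) = 1` as well (`e(v|p) ∣ e(𝔓|p) = 1` for any prime `𝔓` of `L` above `v`). [cite: NeukirchANT1999, Ch. I §8] -/
theorem ramificationIdx_eq_one_below (v : HeightOneSpectrum (𝓞 K₁)) (hv : ((p : ℕ) : 𝓞 K₁) ∈ v.asIdeal)
    (h : ∀ 𝔔 : HeightOneSpectrum (𝓞 L), ((p : ℕ) : 𝓞 L) ∈ 𝔔.asIdeal → 𝔔.asIdeal.ramificationIdx ℤ = 1) :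
    v.asIdeal.ramificationIdx ℤ = 1 := by
  obtain ⟨𝔓, h𝔓⟩ := exists_liesOver (L := L) v
  have hP : ((p : ℕ) : 𝓞 L) ∈ 𝔓.asIdeal := natCast_mem_of_liesOver_ideal hv
  have hdvd : v.asIdeal.ramificationIdx ℤ ∣ 𝔓.asIdeal.ramificationIdx ℤ :=
    Ideal.ramificationIdx_below_dvd (R := ℤ) v.asIdeal 𝔓.asIdeal
  rw [h 𝔓 hP, Nat.dvd_one] at hdvd
  exact hdvd

variable [IsGalois K₁ L]

/-- **`ψ ∘ N_{L/K₁}` is ramified at every prime of `L` above a prime `v ∋ p` where `ψ` is ramified**, provided every prime of `L`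
above `p` has `e = 1` over `ℤ` (so `v` is unramified in `L`; Childress Lemma 5.3 (a) via the tree's
`HeckeCharacter.not_isUnramifiedAt_compRelNorm`). [cite: Childress2009, Ch. 4 §5 Lemma 5.3 (a) (PDF p. 95)] -/
theorem not_isUnramifiedAt_compRelNorm (ψ : HeckeCharacter K₁) {v : HeightOneSpectrum (𝓞 K₁)}
    (hv : ((p : ℕ) : 𝓞 K₁) ∈ v.asIdeal) (hψ : ¬ ψ.IsUnramifiedAt v)
    (h : ∀ 𝔔 : HeightOneSpectrum (𝓞 L), ((p : ℕ) : 𝓞 L) ∈ 𝔔.asIdeal → 𝔔.asIdeal.ramificationIdx ℤ = 1)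
    {𝔓 : HeightOneSpectrum (𝓞 L)} (h𝔓 : 𝔓.under (𝓞 K₁) = v) : ¬ (ψ.compRelNorm L).IsUnramifiedAt 𝔓 :=
  ψ.not_isUnramifiedAt_compRelNorm (isUnramifiedIn_of_forall_ramificationIdx_eq_one v hv h) hψ h𝔓

/-- The same for `(ψ ∘ N_{L/K₁}) · ν` with `ν` unramified at `𝔓` (e.g. `ν` a power of the norm, or any twist unramified above
`p`): ramification is unchanged by an unramified factor. [cite: TateThesis1967, §2.3] -/
theorem not_isUnramifiedAt_compRelNorm_mul (ψ : HeckeCharacter K₁) {ν : HeckeCharacter L}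
    {v : HeightOneSpectrum (𝓞 K₁)} (hv : ((p : ℕ) : 𝓞 K₁) ∈ v.asIdeal) (hψ : ¬ ψ.IsUnramifiedAt v)
    (h : ∀ 𝔔 : HeightOneSpectrum (𝓞 L), ((p : ℕ) : 𝓞 L) ∈ 𝔔.asIdeal → 𝔔.asIdeal.ramificationIdx ℤ = 1)
    {𝔓 : HeightOneSpectrum (𝓞 L)} (h𝔓 : 𝔓.under (𝓞 K₁) = v) (hν : ν.IsUnramifiedAt 𝔓) :
    ¬ (ψ.compRelNorm L * ν).IsUnramifiedAt 𝔓 := fun hmul ↦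
  not_isUnramifiedAt_compRelNorm ψ hv hψ h h𝔓 ((KatzCM.isUnramifiedAt_mul_iff_of_range hν).mp hmul)

/-! ### §2 Bad reduction persists above `p` at ramification index one; `ψ_W` is ramified at `v` -/

omit [IsGalois K₁ L] in
/-- **Additive potentially good reduction at `p ≥ 5` stays BAD at every prime of ramification index one**: for `W/ℚ` with
`Addv W p`, `0 ≤ ord_p j(W)`, a number field `F` and a prime `w ∋ p` of `F` with `e(w|p) = 1`, `W_F` does not have good reduction
at `w` — good reduction upstairs would force the semistability index `e_W(p)` to divide `e(w|p) = 1` (Silverman *AEC* VII.5.1 via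
the tree's `semistabilityIndex_dvd_ramificationIdx_of_hasGoodReductionAt`), but `e_W(p) ≠ 1` at an additive prime
(`semistabilityIndex_ne_one_of_addv`). [cite: SilvermanAEC2009, Prop. VII.5.1] -/
theorem not_hasGoodReductionAt_baseChange_of_ramificationIdx_eq_one (W : WeierstrassCurve ℚ) [W.IsElliptic]
    [W.IsGloballyMinimal] (hp5 : 5 ≤ p) (hadd : Rank1Residual.Addv W p) (hj : 0 ≤ padicValRat p W.j)
    (F : Type) [Field F] [NumberField F] (w : HeightOneSpectrum (𝓞 F)) (hw : ((p : ℕ) : 𝓞 F) ∈ w.asIdeal)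
    (he : w.asIdeal.ramificationIdx ℤ = 1) : ¬ (W.baseChange F).HasGoodReductionAt w := by
  intro hgood
  have hdvd := Rank1Residual.Additive.semistabilityIndex_dvd_ramificationIdx_of_hasGoodReductionAt W p F w hw hgood
  haveI := w.isPrime
  haveI := liesOver_span_of_mem (L := F) hw
  have hne : (Ideal.span {((p : ℕ) : ℤ)} : Ideal ℤ) ≠ ⊥ := by
    rw [Ne, Ideal.span_singleton_eq_bot]
    exact_mod_cast hp.out.ne_zero
  rw [Ideal.ramificationIdx'_eq_ramificationIdx (Ideal.span {((p : ℕ) : ℤ)}) w.asIdeal hne, he, Nat.dvd_one] at hdvd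
  exact Rank1Residual.Additive.semistabilityIndex_ne_one_of_addv W p hp5 hadd hj hdvd

omit [IsGalois K₁ L] in
/-- **A CM curve bad at `p ≥ 5` stays bad at every prime of ramification index one** (CM ⇒ `j ∈ ℤ` ⇒ potentially good,
`exists_intCast_eq_j_of_hasCM`; CM and bad ⇒ additive, `not_mult_of_hasCM`). [cite: SilvermanATAEC1994, Thm. II.6.4] -/
theorem not_hasGoodReductionAt_baseChange_of_hasCM (W : WeierstrassCurve ℚ) [W.IsElliptic] [W.IsGloballyMinimal]
    (hp5 : 5 ≤ p) (hCM : W.HasCM) (hbad : ¬ Rank1Residual.Good W p)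
    (F : Type) [Field F] [NumberField F] (w : HeightOneSpectrum (𝓞 F)) (hw : ((p : ℕ) : 𝓞 F) ∈ w.asIdeal)
    (he : w.asIdeal.ramificationIdx ℤ = 1) : ¬ (W.baseChange F).HasGoodReductionAt w := by
  have hadd : Rank1Residual.Addv W p := ⟨hbad, Rank1Residual.not_mult_of_hasCM W hCM p⟩
  have hj : 0 ≤ padicValRat p W.j := by
    obtain ⟨n, hn⟩ := WeierstrassCurve.exists_intCast_eq_j_of_hasCM W hCM
    rw [← hn, padicValRat.of_int]
    exact Int.natCast_nonneg _
  exact not_hasGoodReductionAt_baseChange_of_ramificationIdx_eq_one W hp5 hadd hj F w hw he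

omit [IsGalois K₁ L] in
/-- **`ψ_W` is ramified at `v`** for a Hecke character `ψ` of `K₁` satisfying Deuring's clause (iii) «`ψ` unramified at `w` iff
`W_{K₁}` has good reduction at `w`» (the shape of `Deuring_exists_heckeCharacter_of_maximalCM` (iii), a binder here), `W` CM and
bad at `p ≥ 5`, `v ∋ p` a prime of `K₁` with `e(v|p) = 1` (e.g. `p` inert in `K₁ = K_CM`). [cite: SilvermanATAEC1994, Ch. II Thm. 9.2 (b)] -/
theorem not_isUnramifiedAt_of_deuring (W : WeierstrassCurve ℚ) [W.IsElliptic] [W.IsGloballyMinimal] (hp5 : 5 ≤ p)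
    (hCM : W.HasCM) (hbad : ¬ Rank1Residual.Good W p) {ψ : HeckeCharacter K₁}
    (hψ : ∀ w : HeightOneSpectrum (𝓞 K₁), ψ.IsUnramifiedAt w ↔ (W.baseChange K₁).HasGoodReductionAt w)
    {v : HeightOneSpectrum (𝓞 K₁)} (hv : ((p : ℕ) : 𝓞 K₁) ∈ v.asIdeal) (he : v.asIdeal.ramificationIdx ℤ = 1) :
    ¬ ψ.IsUnramifiedAt v := fun h ↦
  not_hasGoodReductionAt_baseChange_of_hasCM W hp5 hCM hbad K₁ v hv he ((hψ v).mp h)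

/-! ### §3 At the route's frame: `λ = (ψ_W ∘ N_{L/K_CM}) · ν` is ramified above `p` -/

/-- **(R) at the branch.** `W/ℚ` CM and bad at `p ≥ 5`; `L` a quartic number field containing a square root `x` of an integer
`d` that is a non-square mod `p` and having two distinct primes `𝔓₁ ≠ 𝔓₂` above `p` (the biquadratic `L = K_CM·K′` with `p` split
in `K′`: `…BiquadraticPrimes`); `K₁ ⊂ L` Galois (route: `K₁ = K_CM`) with a prime `v ∋ p`; `ψ` a Hecke character of `K₁` with
Deuring's clause (iii) for `W`; `ν` a Hecke character of `L` unramified at the primes above `p`. Then `(ψ.compRelNorm L) * ν` is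
RAMIFIED at every prime `𝔓` of `L` above `v` — the hypothesis `hramS`/`hramT` of `…KatzHsiehDisplay.exists_span_C_mul_eq` on
`{w ∣ p} ⊇ Σ_p = {𝔓′}` for the branch character `λ = ψ_W∘N_{L/K_CM}·N_L⁻¹` of the V2 memo (given that `N_L⁻¹` is unramified).
[cite: Childress2009, Ch. 4 §5 Lemma 5.3 (a) (PDF p. 95)] [cite: SilvermanATAEC1994, Ch. II Thm. 9.2 (b)] -/
theorem branch_not_isUnramifiedAt (W : WeierstrassCurve ℚ) [W.IsElliptic] [W.IsGloballyMinimal] (hp5 : 5 ≤ p)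
    (hCM : W.HasCM) (hbad : ¬ Rank1Residual.Good W p) (h4 : finrank ℚ L = 4) {d : ℤ}
    (hd : ¬ IsSquare ((d : ℤ) : ZMod p)) {x : 𝓞 L} (hx : x ^ 2 = (d : 𝓞 L)) {𝔓₁ 𝔓₂ : HeightOneSpectrum (𝓞 L)}
    (h₁ : ((p : ℕ) : 𝓞 L) ∈ 𝔓₁.asIdeal) (h₂ : ((p : ℕ) : 𝓞 L) ∈ 𝔓₂.asIdeal) (hne : 𝔓₁ ≠ 𝔓₂)
    {v : HeightOneSpectrum (𝓞 K₁)} (hv : ((p : ℕ) : 𝓞 K₁) ∈ v.asIdeal) {ψ : HeckeCharacter K₁}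
    (hψ : ∀ w : HeightOneSpectrum (𝓞 K₁), ψ.IsUnramifiedAt w ↔ (W.baseChange K₁).HasGoodReductionAt w)
    {ν : HeckeCharacter L} {𝔓 : HeightOneSpectrum (𝓞 L)} (h𝔓 : 𝔓.under (𝓞 K₁) = v) (hν : ν.IsUnramifiedAt 𝔓) :
    ¬ (ψ.compRelNorm L * ν).IsUnramifiedAt 𝔓 := by
  have hall : ∀ 𝔔 : HeightOneSpectrum (𝓞 L), ((p : ℕ) : 𝓞 L) ∈ 𝔔.asIdeal → 𝔔.asIdeal.ramificationIdx ℤ = 1 :=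
    fun 𝔔 hQ ↦ ((primes_above_eq_and_degrees h4 hd hx h₁ h₂ hne).2 𝔔 hQ).1
  have hev : v.asIdeal.ramificationIdx ℤ = 1 := ramificationIdx_eq_one_below (L := L) v hv hall
  exact not_isUnramifiedAt_compRelNorm_mul ψ hv (not_isUnramifiedAt_of_deuring W hp5 hCM hbad hψ hv hev) hall h𝔓 hν

/-! ### §4 (appended) `p` inert in `K₁ ∋ √d`: THE prime above `p`; (R) at every prime of `L` above `p` -/

omit [IsGalois K₁ L] in
/-- **`p` is inert in a quadratic field containing `√d`, `d` a non-square mod `p`**: if `[K₁ : ℚ] = 2` and `y ∈ 𝓞 K₁` with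
`y² = d`, then any two primes `u, v ∋ p` of `K₁` coincide and `e(v|p) = 1`, `f(v|p) = 2` (every prime above `p` has `f ≥ 2`
by `…BiquadraticPrimes.two_le_inertiaDeg`; fundamental identity `∑ e f = 2`). Route: `K₁ = K_CM = ℚ(√d_CM)`, `p` CM-inert.
[cite: NeukirchANT1999, Ch. I §8 (Prop. 8.2, fundamental identity)] -/
theorem eq_and_degrees_of_inert (h2K : finrank ℚ K₁ = 2) {d : ℤ} (hd : ¬ IsSquare ((d : ℤ) : ZMod p)) {y : 𝓞 K₁}
    (hy : y ^ 2 = (d : 𝓞 K₁)) {u v : HeightOneSpectrum (𝓞 K₁)} (hu : ((p : ℕ) : 𝓞 K₁) ∈ u.asIdeal)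
    (hv : ((p : ℕ) : 𝓞 K₁) ∈ v.asIdeal) :
    u = v ∧ v.asIdeal.ramificationIdx ℤ = 1 ∧ v.asIdeal.inertiaDeg ℤ = 2 := by
  set P : Ideal ℤ := Ideal.span {((p : ℕ) : ℤ)} with hPdef
  haveI hPmax : P.IsMaximal := isMaximal_span_natPrime
  have hsum := Ideal.sum_ramification_inertia_eq_finrank P (𝓞 K₁)
  rw [RingOfIntegers.rank, h2K] at hsum
  have hge : ∀ q : P.primesOver (𝓞 K₁), 2 ≤ q.1.ramificationIdx ℤ * q.1.inertiaDeg ℤ := by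
    intro q
    have hq : ((p : ℕ) : 𝓞 K₁) ∈ q.1 := mem_of_liesOver_span
    have hf := two_le_inertiaDeg hd hy hq
    have he : 0 < q.1.ramificationIdx ℤ := Ideal.ramificationIdx_pos q.1 ℤ
    nlinarith
  haveI := u.isPrime
  haveI := v.isPrime
  haveI := liesOver_span_of_mem hu
  haveI := liesOver_span_of_mem hv
  set Qu : P.primesOver (𝓞 K₁) := Ideal.primesOver.mk P u.asIdeal with hQu
  set Qv : P.primesOver (𝓞 K₁) := Ideal.primesOver.mk P v.asIdeal with hQv
  have hcard : Fintype.card (P.primesOver (𝓞 K₁)) ≤ 1 := by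
    have h := Finset.card_nsmul_le_sum (Finset.univ : Finset (P.primesOver (𝓞 K₁))) _ 2 (fun q _ ↦ hge q)
    rw [hsum, smul_eq_mul] at h
    rw [← Finset.card_univ]
    omega
  have huv : u = v := by
    by_contra hne
    have hQne : Qu ≠ Qv := fun h ↦ hne (HeightOneSpectrum.ext (congrArg Subtype.val h))
    have h2 : ({Qu, Qv} : Finset (P.primesOver (𝓞 K₁))).card ≤ Fintype.card (P.primesOver (𝓞 K₁)) := by
      rw [← Finset.card_univ]
      exact Finset.card_le_card (Finset.subset_univ _)
    rw [Finset.card_pair hQne] at h2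
    omega
  refine ⟨huv, ?_⟩
  -- the single summand is `2`
  have huniv : (Finset.univ : Finset (P.primesOver (𝓞 K₁))) = {Qv} := by
    symm
    apply Finset.eq_of_subset_of_card_le (Finset.subset_univ _)
    rw [Finset.card_singleton, Finset.card_univ]
    have : 0 < Fintype.card (P.primesOver (𝓞 K₁)) := Fintype.card_pos_iff.mpr ⟨Qv⟩
    omega
  have hval : v.asIdeal.ramificationIdx ℤ * v.asIdeal.inertiaDeg ℤ = 2 := by
    have h := hsum
    rw [huniv, Finset.sum_singleton] at h
    exact h
  have hf := two_le_inertiaDeg hd hy hv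
  have he : 0 < v.asIdeal.ramificationIdx ℤ := Ideal.ramificationIdx_pos v.asIdeal ℤ
  constructor <;> nlinarith

omit [NumberField K₁] [NumberField L] hp [IsGalois K₁ L] in
/-- A prime of `L` containing `p` lies under a prime of `K₁` containing `p`. [folklore] -/
theorem natCast_mem_under {𝔓 : HeightOneSpectrum (𝓞 L)} (hP : ((p : ℕ) : 𝓞 L) ∈ 𝔓.asIdeal) :
    ((p : ℕ) : 𝓞 K₁) ∈ (𝔓.under (𝓞 K₁)).asIdeal := by
  change ((p : ℕ) : 𝓞 K₁) ∈ 𝔓.asIdeal.under (𝓞 K₁)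
  rw [Ideal.mem_comap, map_natCast]
  exact hP

/-- **(R) at EVERY prime of `L` above `p`.** As `branch_not_isUnramifiedAt`, with `K₁ = ℚ(√d)` quadratic (`y ∈ 𝓞 K₁`, `y² = d`,
so `p` is INERT in `K₁`, `eq_and_degrees_of_inert`, and every prime of `L` above `p` lies over THE prime `v` of `K₁` above `p`):
for every prime `𝔓 ∋ p` of `L` (i.e. `𝔓 ∈ KatzCM.primesOver L p`) and every `ν` unramified at `𝔓`, `(ψ.compRelNorm L) * ν` is
ramified at `𝔓` — verbatim the shape of `hramS` (on `{w ∣ p}`) / `hramT` (on `Σ_p = {𝔓′} ⊆ {w ∣ p}`) of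
`…KatzHsiehDisplay.exists_span_C_mul_eq` for `λ = ψ_W∘N_{L/K_CM}·N_L⁻¹`.
[cite: Childress2009, Ch. 4 §5 Lemma 5.3 (a) (PDF p. 95)] [cite: SilvermanATAEC1994, Ch. II Thm. 9.2 (b)] -/
theorem branch_not_isUnramifiedAt_of_natCast_mem (W : WeierstrassCurve ℚ) [W.IsElliptic] [W.IsGloballyMinimal] (hp5 : 5 ≤ p)
    (hCM : W.HasCM) (hbad : ¬ Rank1Residual.Good W p) (h2K : finrank ℚ K₁ = 2) (h4 : finrank ℚ L = 4) {d : ℤ}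
    (hd : ¬ IsSquare ((d : ℤ) : ZMod p)) {y : 𝓞 K₁} (hy : y ^ 2 = (d : 𝓞 K₁)) {𝔓₁ 𝔓₂ : HeightOneSpectrum (𝓞 L)}
    (h₁ : ((p : ℕ) : 𝓞 L) ∈ 𝔓₁.asIdeal) (h₂ : ((p : ℕ) : 𝓞 L) ∈ 𝔓₂.asIdeal) (hne : 𝔓₁ ≠ 𝔓₂)
    {v : HeightOneSpectrum (𝓞 K₁)} (hv : ((p : ℕ) : 𝓞 K₁) ∈ v.asIdeal) {ψ : HeckeCharacter K₁}
    (hψ : ∀ w : HeightOneSpectrum (𝓞 K₁), ψ.IsUnramifiedAt w ↔ (W.baseChange K₁).HasGoodReductionAt w)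
    {ν : HeckeCharacter L} {𝔓 : HeightOneSpectrum (𝓞 L)} (hP : ((p : ℕ) : 𝓞 L) ∈ 𝔓.asIdeal) (hν : ν.IsUnramifiedAt 𝔓) :
    ¬ (ψ.compRelNorm L * ν).IsUnramifiedAt 𝔓 := by
  have hx : (algebraMap (𝓞 K₁) (𝓞 L) y) ^ 2 = (d : 𝓞 L) := by rw [← map_pow, hy, map_intCast]
  have h𝔓 : 𝔓.under (𝓞 K₁) = v := (eq_and_degrees_of_inert h2K hd hy (natCast_mem_under hP) hv).1
  exact branch_not_isUnramifiedAt W hp5 hCM hbad h4 hd hx h₁ h₂ hne hv hψ h𝔓 hν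

end Summit.BirchSwinnertonDyer.BirchSwinnertonDyer.Theorems.BiquadraticEisensteinDescentEisensteinHeartFlatCMInertBadKPrimeBranchRamification

end
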